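import Summits.QuantumFields.BalabanUV.Beta.AxialDressingRootedSupport
import Summits.QuantumFields.BalabanUV.Beta.ChartConjugationRelativeEnd

/-!
# The ROOTED axial dressing `Πᵀ_ρ` — part 8: REFLECTION INVARIANCE of the CENTRED projector kernel and of the co-dressed
# resolvent (`refK (Φ N α) (piK ctr N) = piK ctr N`, `refK (Φ Lc α) G_j = G_j`)

HONEST FRAMING (cell charter, verbatim): «discharging BetaPertH makes Balaban's UV stability UNCONDITIONAL — a real
constructive-QFT result; it is NOT the continuum limit and NOT the Clay problem.»  DERIVED cell leaf (pub-balaban β sub-cell,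
lane an2 gen 12, item (ii-2a) of NOTE X-an2-41 §4, file 2 of 2); no statement of Bałaban's papers is typed here, no `[cite:]` tag,
no `Prop` fact; it instantiates no binder of the β-function wall by itself — it DISCHARGES one binder of an2's own conditional END
`ChartConjugationRelativeEnd.axisReflectionCovariant_flipK_TbalOf_dressAt_rel` (the reflection invariance `hGr` of the co-dressed step
resolvents) at the centred root for odd `Lc`.  NOT `BetaPertH`; NOT continuum; NOT Clay.

## What is here

* §2 `treeGaugeAt_map` / `axProjAt_map` (additive maps of coefficients, from an2's `AxialProjector.axial_map`), `pm_cast`, `R1_bondInd`,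
  and the MATRIX FORM of an5's `RootedComb.axProjAt_R1`: **`pm_refl`** — at the centred root, `N` odd, every axis `α`,
  `pm b p a q = ε_a ε_b · pm b (bref α b p) a (bref α a q)`.
* §3 **`refK_piK`**: `refK (Φ N α) (piK (toSite (ctrOff (d+1) N)) N) = piK …` (`Odd N`; field block by `pm_refl` + the window lemmas of
  part 7, multiplier block because `mref` is a bijection), `refK_trK`, and — through `KernelReflection.comp_refK` —
  **`refK_coDressKAt`** (a spread reflection-invariant `K` has a reflection-invariant co-dressed kernel) and **`refK_coDressKAt_KInvStep`**
  (`ResolventReflection.refK_KInvStep` BY NAME).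
* §4 **`axisReflectionCovariant_flipK_TbalOf_dressCtr_rel`**: an2's dressed-family END `ChartConjugationRelativeEnd.axisReflectionCovariant_flipK_TbalOf_dressAt_rel`
  AT THE CENTRED ROOT with its binder `hGr` DISCHARGED by §3 — the `hR` hypothesis of `OneStepKernelFamily.d1Drift_of_D1Tel_D1Rep` for the
  centred dressed family `fun j ↦ dressAt (ctrOff_mem_box _) (Js⁰ j)` (`Odd Lc`; the shape of `SpineRooted.JsBalAn1AtCtr`) from the remaining
  BINDERS only: `RelInv G_j (𝕄 j) E` (item (ii-1)), the contact families commuting with `E`, and the six jet laws of the UNDRESSED jets.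

All declarations `[folklore]`; axioms standard.
Provenance: b2b-balaban β sub-cell, unit beta-an2 gen 12, 2026-08-19 (v1); over part 7, an5's `RootedComb.axProjAt_R1` /
`ResolventReflection`, an2's `AxialProjector.axial_map` BY NAME; no existing file touched.
-/

open Finset
open scoped BigOperators
open Literature.MathematicalPhysics.QuantumFieldTheory
open Literature.MathematicalPhysics.QuantumFieldTheory.Balaban1983to89
open Literature.MathematicalPhysics.QuantumFieldTheory.Balaban1983to89.Beta
open B12Sec2to5 (l1 l1_nonneg)
open ExpKernelCalculus (MKer Decays BiLoc comp tr shiftK)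
open AffineAveraging (Form0 Form1 box toSite unitVec unitVec_apply)
open AveragingContours (blk segUp segDown seg corner axialAux axial grad)
open AveragingContoursRooted (treeGaugeAt ctrOff ctr ctrOff_mem_box)
open RootedComb (axProjAt axProjAt_apply axProjAt_R1 ctr_eq_toSite)
open AxialProjector (zsmul_blk_le lt_zsmul_blk_add axial_map)
open PolarizationSign (reflSign)
open KernelReflection (LegMap refK refK_apply comp_refK)
open ResolventReflection (sref sref_apply bref bref_apply bref_bref mref mref_mref R1 Φ Φ_r_inl Φ_r_inr Φ_s_inl Φ_s_inr reflSign_mul_self refK_KInvStep)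
open OneStepResolventKernel (Fib LocStencil JetData)
open OneStepKernelFamily (KInvStep decays_KInvStep vertexOfK TbalOf flipK)
open PolarizationSign (AxisReflectionCovariant)
open Summit.QuantumFields.BalabanUV.Beta.TameKernelCalculus

namespace Summit.QuantumFields.BalabanUV.Beta.AxialDressingRooted

noncomputable section

variable {n : ℕ}

/-! ## §2 Additive maps of coefficients; the matrix form of `axProjAt_R1` -/

section MatrixRefl

variable {R R' : Type*} [AddCommGroup R] [AddCommGroup R']

/-- [folklore] The rooted tree integral commutes with additive maps of the coefficients. -/
theorem treeGaugeAt_map (φ : R →+ R') (ρ : Fin n → ℤ) (A : Form1 n R) (L : ℕ) (x : Fin n → ℤ) :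
    treeGaugeAt ρ (fun κ z => φ (A κ z)) L x = φ (treeGaugeAt ρ A L x) := by
  unfold treeGaugeAt
  rw [axial_map, map_list_sum]

/-- [folklore] The rooted projector commutes with additive maps of the coefficients. -/
theorem axProjAt_map (φ : R →+ R') (ρ : Fin n → ℤ) (L : ℕ) (A : Form1 n R) (κ : Fin n) (x : Fin n → ℤ) :
    axProjAt ρ L (fun κ z => φ (A κ z)) κ x = φ (axProjAt ρ L A κ x) := by
  rw [axProjAt_apply, axProjAt_apply, treeGaugeAt_map, treeGaugeAt_map, map_sub, map_sub]

/-- [folklore] The real cast of the matrix entry is the rooted projector of the real bond indicator. -/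
theorem pm_cast (ρ : Fin n → ℤ) (N : ℕ) (β : Fin n) (p : Fin n → ℤ) (α : Fin n) (q : Fin n → ℤ) :
    (pm ρ N β p α q : ℝ) = axProjAt ρ N (fun κ z => (bondInd α q κ z : ℝ)) β p := by
  rw [pm_eq]
  exact (axProjAt_map (Int.castAddHom ℝ) ρ N (bondInd α q) β p).symm

/-- [folklore] The bond reflection transports bond indicators: `ε_κ · δ_{(a, bref a q)}(κ, bref κ x) = ε_a · δ_{(a,q)}(κ, x)`. -/
theorem R1_bondInd (α a : Fin n) (q : Fin n → ℤ) :
    R1 α (fun κ z => (bondInd a (bref α a q) κ z : ℝ)) = fun κ x => reflSign α a * (bondInd a q κ x : ℝ) := by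
  funext κ x
  simp only [R1, bondInd_apply]
  by_cases hκ : κ = a
  · subst hκ
    by_cases hx : x = q
    · subst hx; simp
    · have hx' : bref α κ x ≠ bref α κ q := fun e => hx (by simpa using congrArg (bref α κ) e)
      simp [hx, hx']
  · simp [hκ]

/-- [folklore] **THE MATRIX FORM OF `RootedComb.axProjAt_R1`** (centred root, `N` odd, every axis `α`):
`pm b p a q = ε_a ε_b · pm b (bref α b p) a (bref α a q)` — the projector matrix commutes with the bond reflection. -/
theorem pm_refl {N : ℕ} (hN : Odd N) (α b : Fin n) (p : Fin n → ℤ) (a : Fin n) (q : Fin n → ℤ) :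
    (pm (toSite (ctrOff n N)) N b p a q : ℝ) =
      reflSign α a * reflSign α b * (pm (toSite (ctrOff n N)) N b (bref α b p) a (bref α a q) : ℝ) := by
  have key := congrFun (congrFun (axProjAt_R1 hN α (fun κ z => (bondInd a (bref α a q) κ z : ℝ))) b) p
  rw [← ctr_eq_toSite]
  -- right side of `key`
  have eR : R1 α (axProjAt (ctr n N) N fun κ z => (bondInd a (bref α a q) κ z : ℝ)) b p =
      reflSign α b * (pm (ctr n N) N b (bref α b p) a (bref α a q) : ℝ) := by
    simp only [R1, pm_cast]
  -- left side of `key`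
  have eL : axProjAt (ctr n N) N (R1 α fun κ z => (bondInd a (bref α a q) κ z : ℝ)) b p =
      reflSign α a * (pm (ctr n N) N b p a q : ℝ) := by
    rw [R1_bondInd, pm_cast]
    exact axProjAt_map (AddMonoidHom.mulLeft (reflSign α a)) (ctr n N) N (fun κ z => (bondInd a q κ z : ℝ)) b p
  rw [eL, eR] at key
  have hs := reflSign_mul_self α a
  calc (pm (ctr n N) N b p a q : ℝ) = reflSign α a * reflSign α a * (pm (ctr n N) N b p a q : ℝ) := by rw [hs, one_mul]
    _ = reflSign α a * (reflSign α b * (pm (ctr n N) N b (bref α b p) a (bref α a q) : ℝ)) := by rw [mul_assoc, key]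
    _ = _ := by ring

end MatrixRefl

/-! ## §3 Reflection invariance of the centred projector kernel and of the co-dressed resolvent -/

section Refl

variable {d : ℕ}

/-- [folklore] `mref` is injective (an involution). -/
theorem mref_inj {N : ℕ} {α κ : Fin (d + 1)} {x x' : Fin (d + 1) → ℤ} : mref N α κ x = mref N α κ x' ↔ x = x' :=
  ⟨fun h => by simpa using congrArg (mref N α κ) h, fun h => by rw [h]⟩

/-- [folklore] **REFLECTION INVARIANCE OF THE CENTRED PROJECTOR KERNEL** (`N` odd, every axis `α`):
`refK (Φ N α) (piK ctr N) = piK ctr N` — the field block by `pm_refl` and the window lemmas of §1, the multiplier block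
because `mref` is a bijection. -/
theorem refK_piK {N : ℕ} (hN : Odd N) (α : Fin (d + 1)) :
    refK (Φ N α) (piK (toSite (ctrOff (d + 1) N)) N) = piK (d := d) (toSite (ctrOff (d + 1) N)) N := by
  have hN1 : 1 ≤ N := hN.pos
  have hr : ctrOff (d + 1) N ∈ box (d + 1) N := ctrOff_mem_box hN1
  funext x x' a b
  rw [refK_apply]
  rcases a with a | m <;> rcases b with b | m'
  · simp only [Φ_s_inl, Φ_r_inl, piK_inl_inl]
    by_cases h0 : (pm (toSite (ctrOff (d + 1) N)) N b x' a x : ℝ) = 0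
    · have h0' : (pm (toSite (ctrOff (d + 1) N)) N b (bref α b x') a (bref α a x) : ℝ) = 0 := by
        have e := pm_refl hN α b x' a x
        rw [h0] at e
        have hsa := reflSign_mul_self α a
        have hsb := reflSign_mul_self α b
        have : reflSign α a * reflSign α b ≠ 0 := by
          intro hz
          have := congrArg (fun t => t * (reflSign α a * reflSign α b)) hz
          simp only [zero_mul] at this
          nlinarith [hsa, hsb]
        rcases mul_eq_zero.1 e.symm with h1 | h1
        · exact absurd h1 this
        · exact h1
      rw [h0']
      split_ifs <;> simp [h0]
    · have h0z : pm (toSite (ctrOff (d + 1) N)) N b x' a x ≠ 0 := fun e => h0 (by rw [e, Int.cast_zero])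
      rw [if_pos (window_refl_of_pm_ne_zero hN1 hr h0z α), if_pos (window_of_pm_ne_zero hN1 hr h0z), pm_refl hN α b x' a x]
  · simp [piK_inl_inr]
  · simp [piK_inr_inl]
  · simp only [Φ_s_inr, Φ_r_inr, piK_inr_inr]
    by_cases hm : m = m'
    · subst hm
      rw [reflSign_mul_self, one_mul]
      by_cases hx : x = x'
      · subst hx; simp
      · have hx' : mref N α m x ≠ mref N α m x' := fun e => hx (mref_inj.1 e)
        simp [hx, hx']
    · simp [hm]

/-- [folklore] Relabelling commutes with transposition. -/
theorem refK_trK (L : LegMap (d + 1) (Fib d)) (K : MKer (d + 1) (Fib d)) : refK L (trK K) = trK (refK L K) := by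
  funext x y a b
  simp only [refK_apply, trK, mul_comm]

/-- [folklore] **REFLECTION INVARIANCE OF THE CO-DRESSED KERNEL** (centred root, `N` odd): a spread, reflection-invariant `K` has a
reflection-invariant co-dressed kernel `coDressKAt ctr N K` (`KernelReflection.comp_refK` twice, `refK_piK`). -/
theorem refK_coDressKAt {N : ℕ} (hN : Odd N) {K : MKer (d + 1) (Fib d)} (hK : Spr K) (α : Fin (d + 1))
    (hKr : refK (Φ N α) K = K) :
    refK (Φ N α) (coDressKAt (toSite (ctrOff (d + 1) N)) N K) = coDressKAt (toSite (ctrOff (d + 1) N)) N K := by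
  have hN1 : 1 ≤ N := hN.pos
  have hr : ctrOff (d + 1) N ∈ box (d + 1) N := ctrOff_mem_box hN1
  have sP : Spr (piK (d := d) (toSite (ctrOff (d + 1) N)) N) := spr_piK hN1 hr
  have sPt : Spr (trK (piK (d := d) (toSite (ctrOff (d + 1) N)) N)) := spr_trK_piK hN1 hr
  rw [coDressKAt_eq, ← comp_refK (Φ N α) (fun x z a f b => slice_tame (spr_comp sPt hK).tame sP.tame x z a f b),
    ← comp_refK (Φ N α) (fun x z a f b => slice_tame sPt.tame hK.tame x z a f b), refK_trK, refK_piK hN α, hKr]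

/-- [folklore] **THE BINDER `hGr` OF `ChartConjugationRelativeEnd.axisReflectionCovariant_flipK_TbalOf_dressAt_rel` DISCHARGED AT THE
CENTRED ROOT** (`Lc` odd): `refK (Φ Lc α) G_j = G_j` for `G_j := coDressKAt ctr Lc (KInvStep Lc j)` (`ResolventReflection.refK_KInvStep`). -/
theorem refK_coDressKAt_KInvStep {Lc : ℕ} [NeZero Lc] (hLc : Odd Lc) (j : ℕ) (α : Fin (d + 1)) :
    refK (Φ Lc α) (coDressKAt (toSite (ctrOff (d + 1) Lc)) Lc (KInvStep (d := d) Lc j)) =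
      coDressKAt (toSite (ctrOff (d + 1) Lc)) Lc (KInvStep (d := d) Lc j) := by
  obtain ⟨δ, C, hδ, -, hK⟩ := decays_KInvStep (d := d) (Lc := Lc) j
  exact refK_coDressKAt hLc ⟨C, δ, hδ, hK⟩ α (refK_KInvStep j α)

end Refl

/-! ## §4 The `hR` END for the CENTRED dressed family, reflection invariance discharged -/

section Wiring

open Summit.QuantumFields.BalabanUV.Beta.ChartConjugation (conjV conjW)
open Summit.QuantumFields.BalabanUV.Beta.ChartConjugationRelative (RelInv)
open Summit.QuantumFields.BalabanUV.Beta.ChartConjugationRelativeEnd (axisReflectionCovariant_flipK_TbalOf_dressAt_rel)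

/-- [folklore] **THE `hR` BINDER FOR THE CENTRED DRESSED WALL FAMILY, `Odd Lc`, OVER THE RELATIVE SOCKETS — reflection invariance
of the co-dressed step resolvents DISCHARGED (`refK_coDressKAt_KInvStep`).**  For UNDRESSED step jets `Js⁰ : ℕ → JetData 3 Lc` the centred
dressed family `fun j ↦ dressAt (ctrOff_mem_box _) (Js⁰ j)` (= `dressCtr ∘ Js⁰`) has `∀ j, AxisReflectionCovariant (flipK (TbalOf Lc … j))`
from the BINDERS: spread `𝕄 j`, `E` with `RelInv G_j (𝕄 j) E`, `G_j := coDressKAt ctr Lc (KInvStep Lc j)` (item (ii-1)); contact families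
`C j α`, `X₂ j α` commuting with `E`; the jet laws (St), (Wt), (Sr-conj), (Wr-conj) of the UNDRESSED jets against `𝕄 j`.  Discharges nothing
of the wall by itself. -/
theorem axisReflectionCovariant_flipK_TbalOf_dressCtr_rel {Lc : ℕ} [NeZero Lc] (hLc : Odd Lc) (Js : ℕ → JetData 3 Lc)
    (M : ℕ → MKer 4 (Fib 3)) (E : MKer 4 (Fib 3)) (hM : ∀ j, Spr (M j)) (hE : Spr E)
    (hR : ∀ j, RelInv (coDressKAt (toSite (ctrOff 4 Lc)) Lc (KInvStep (d := 3) Lc j)) (M j) E)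
    (hSt : ∀ (j : ℕ) (κ' : Fin 4) (u t : Fin 4 → ℤ), (Js j).S κ' (u + (Lc : ℤ) • t) = ExpKernelCalculus.shiftK (-((Lc : ℤ) • t)) ((Js j).S κ' u))
    (hWt : ∀ (j : ℕ) (μ : Fin 4) (y : Fin 4 → ℤ) (ν : Fin 4) (y' t : Fin 4 → ℤ),
      (Js j).W μ (y + t) ν (y' + t) = ExpKernelCalculus.shiftK (-((Lc : ℤ) • t)) ((Js j).W μ y ν y'))
    (C : ℕ → Fin 4 → Fin 4 → (Fin 4 → ℤ) → MKer 4 (Fib 3)) (Cc δc : ℕ → ℝ) (hC : ∀ j α, LocStencil (C j α) (Cc j) (δc j))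
    (hδc : ∀ j, 0 < δc j) (X₂ : ℕ → Fin 4 → Fin 4 → (Fin 4 → ℤ) → Fin 4 → (Fin 4 → ℤ) → MKer 4 (Fib 3))
    (hX₂ : ∀ j α μ y ν y', Loc (X₂ j α μ y ν y'))
    (hEC : ∀ j α κ' u, comp E (C j α κ' u) = comp (C j α κ' u) E)
    (hEX₂ : ∀ j α μ y ν y', comp E (X₂ j α μ y ν y') = comp (X₂ j α μ y ν y') E)
    (hSrC : ∀ (j : ℕ) (α κ' : Fin 4) (u : Fin 4 → ℤ),
      (Js j).S κ' (bref α κ' u) = reflSign α κ' • refK (Φ Lc α) ((Js j).S κ' u + conjV (M j) (C j α κ' u)))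
    (hWrC : ∀ (j : ℕ) (α μ : Fin 4) (y : Fin 4 → ℤ) (ν : Fin 4) (y' : Fin 4 → ℤ),
      (Js j).W μ (bref α μ y) ν (bref α ν y') = (reflSign α μ * reflSign α ν) • refK (Φ Lc α) ((Js j).W μ y ν y' +
        conjW (M j) (vertexOfK (coDressKAt (toSite (ctrOff 4 Lc)) Lc (KInvStep (d := 3) Lc j)) Lc (Js j).S μ y)
          (vertexOfK (coDressKAt (toSite (ctrOff 4 Lc)) Lc (KInvStep (d := 3) Lc j)) Lc (Js j).S ν y')
          (vertexOfK (coDressKAt (toSite (ctrOff 4 Lc)) Lc (KInvStep (d := 3) Lc j)) Lc (C j α) μ y)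
          (vertexOfK (coDressKAt (toSite (ctrOff 4 Lc)) Lc (KInvStep (d := 3) Lc j)) Lc (C j α) ν y') (X₂ j α μ y ν y'))) :
    ∀ j : ℕ, AxisReflectionCovariant
      (flipK (TbalOf Lc (fun j => dressAt (ctrOff_mem_box (d := 4) (one_le_of_neZero Lc)) (Js j)) j)) :=
  axisReflectionCovariant_flipK_TbalOf_dressAt_rel (ctrOff_mem_box (d := 4) (one_le_of_neZero Lc)) Js M E
    (fun j α => refK_coDressKAt_KInvStep (d := 3) hLc j α) hM hE hR hSt hWt C Cc δc hC hδc X₂ hX₂ hEC hEX₂ hSrC hWrC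

end Wiring

end

end Summit.QuantumFields.BalabanUV.Beta.AxialDressingRooted
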